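import Mathlib
import HarnessLib
import Summits.HubbardSuperconductivity.HubbardSuperconductivity.Theorems.KLProgrammeKLRegimeEngineTowerModelDefs

/-!
# Route `KLProgramme` — crux K3 ENGINE (stmt-HubbardSuperconductivity-20437 `KLRegimeEngineV17F2`), stub (b) v2, THE LEVELS PACKAGE (ℓ):
# instantiation (I2), LINEARITY HALF — the measured size of a block's input is at most the sum of the re-measured sizes of the earlier increments
# (E1-LEVELS-BLUEPRINT-g8 (I2); E1 lead r2d-p2 g8)

The kit's re-measurement hypothesis `hμ` of `towerBorn_le_law_split` bounds the Chernoff datum `μ k m` (the input `𝒱_{dk}[K]` of block `k` measured at the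
block's input family `F_{dk−1}`) by a sum over the increments born earlier.  Model side this is TWO facts: (a) LINEARITY — `𝒱_{dk} = 𝒱_0 + Σ_{k′<k} Δ_{k′}`
(`klTowerInput_eq_zero_add_sum`) and the subadditivity of both level currencies (`klWtPinnedSumOf_sum_le`, `klLevNormOf_sum_le`), so the measured size is at most
(size of `𝒱_0` re-measured at `F_{dk−1}`) + Σ_{k′<k} (size of `Δ_{k′}` re-measured at `F_{dk−1}`); (b) the JUMP — each re-measured size at the finer family is at
most the born size at the coarse family times the relative count with the conservation gain (k3c2-p3's …EngineNormsJumpResectorisation* + p4's counts).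
This file is (a), in both currencies:

* `klWtPinnedSumOf_add_le`, `klLevNormOf_add_le` (two summands);
* **`klTowerMeasWt_le_remeasured_sum`** — `klTowerMeasWt … d k m ≤ (⨆ pins, klWtPinnedSumOf … (dk−1) m 𝒱_0) + Σ_{k′<k} ⨆ pins, klWtPinnedSumOf … (dk−1) m Δ_{k′}`;
* **`klTowerMeasLev_le_remeasured_sum`** — the levelled twin at every level-count `F`.
Pure bookkeeping over the carriers of …EngineTowerModelDefs; nothing about the model is asserted.
-/

noncomputable section

namespace Summit.HubbardSuperconductivity.HubbardSuperconductivity.Theorems.EngineV8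

set_option linter.dupNamespace false -- summit = problem name (single-conjunct summit), D-0017

open Real Finset Literature.MathematicalPhysics.QuantumLattice Literature.Probability.LatticeModels
open Literature.MathematicalPhysics.QuantumLattice.FermiRG
open Summit.HubbardSuperconductivity.HubbardSuperconductivity.Theorems.KLRegimeSplit
open Summit.HubbardSuperconductivity.HubbardSuperconductivity.Theorems.KLProgrammeLegKernels
open Summit.HubbardSuperconductivity.HubbardSuperconductivity.Theorems.DispersionFlow

variable {L M : ℕ} [NeZero L]

/-! ## §1 Two-summand subadditivity -/

/-- The weighted pinned sum of `A + B` is at most the sum of those of `A` and `B`. -/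
theorem klWtPinnedSumOf_add_le {β : ℝ} (hβ : 0 ≤ β) (μ : ℝ) (K : TrigPolyC4v) (J m : ℕ) (A B : HubbardGrassmann L M) (q : Fin m)
    (w : SpaceTimeIdx L M × SectorLeg (sectorCount J)) :
    klWtPinnedSumOf L M β μ K J m (A + B) q w ≤ klWtPinnedSumOf L M β μ K J m A q w + klWtPinnedSumOf L M β μ K J m B q w := by
  have h := klWtPinnedSumOf_sum_le hβ μ K J m (univ : Finset (Fin 2)) ![A, B] q w
  simpa [Fin.sum_univ_two] using h

/-- The levelled norm of `A + B` is at most the sum of those of `A` and `B`. -/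
theorem klLevNormOf_add_le {β : ℝ} (hβ : 0 ≤ β) (μ : ℝ) (K : TrigPolyC4v) (J m : ℕ) (A B : HubbardGrassmann L M)
    (Ωe : Fin m → Option (SectorLeg (sectorCount J))) :
    klLevNormOf L M β μ K J m (A + B) Ωe ≤ klLevNormOf L M β μ K J m A Ωe + klLevNormOf L M β μ K J m B Ωe := by
  have h := klLevNormOf_sum_le hβ μ K J m (univ : Finset (Fin 2)) ![A, B] Ωe
  simpa [Fin.sum_univ_two] using h

/-! ## §2 The measured size of a block input against the re-measured sizes of the earlier increments -/

/-- **Pointwise form, weighted**: every weighted pinned sum of the input `𝒱_{dk}` at `F_{dk−1}` is at most the re-measured pinned sum of `𝒱_0` plus those of the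
increments `Δ_{k′}`, `k′ < k`, all at the same family and pin. -/
theorem klWtPinnedSumOf_klTowerInput_le {β : ℝ} (hβ : 0 ≤ β) (U μ : ℝ) (K : TrigPolyC4v) (d k m : ℕ) (q : Fin m)
    (w : SpaceTimeIdx L M × SectorLeg (sectorCount (d * k - 1))) :
    klWtPinnedSumOf L M β μ K (d * k - 1) m (klTowerInput L M β U μ K d k) q w ≤
      klWtPinnedSumOf L M β μ K (d * k - 1) m (klEffectiveAction L M β U μ K klE0 0) q w +
        ∑ k' ∈ range k, klWtPinnedSumOf L M β μ K (d * k - 1) m (klTowerIncr L M β U μ K d k') q w := by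
  rw [klTowerInput_eq_zero_add_sum]
  exact (klWtPinnedSumOf_add_le hβ μ K _ m _ _ q w).trans (by gcongr; exact klWtPinnedSumOf_sum_le hβ μ K _ m _ _ q w)

/-- **Pointwise form, levelled.** -/
theorem klLevNormOf_klTowerInput_le {β : ℝ} (hβ : 0 ≤ β) (U μ : ℝ) (K : TrigPolyC4v) (d k m : ℕ)
    (Ωe : Fin m → Option (SectorLeg (sectorCount (d * k - 1)))) :
    klLevNormOf L M β μ K (d * k - 1) m (klTowerInput L M β U μ K d k) Ωe ≤
      klLevNormOf L M β μ K (d * k - 1) m (klEffectiveAction L M β U μ K klE0 0) Ωe +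
        ∑ k' ∈ range k, klLevNormOf L M β μ K (d * k - 1) m (klTowerIncr L M β U μ K d k') Ωe := by
  rw [klTowerInput_eq_zero_add_sum]
  exact (klLevNormOf_add_le hβ μ K _ m _ _ Ωe).trans (by gcongr; exact klLevNormOf_sum_le hβ μ K _ m _ _ Ωe)

/-- **`μ k ≤` re-measured `𝒱_0` + Σ re-measured increments (weighted track).**  The measured weighted size of the input of block `k` is at most the supremum
over pins of the re-measured pinned sums of `𝒱_0` at `F_{dk−1}` plus, for each `k′ < k`, the supremum over pins of the re-measured pinned sums of `Δ_{k′}` there. -/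
theorem klTowerMeasWt_le_remeasured_sum {β : ℝ} (hβ : 0 ≤ β) (U μ : ℝ) (K : TrigPolyC4v) (d k m : ℕ) :
    klTowerMeasWt L M β U μ K d k m ≤
      (⨆ qw : Fin m × (SpaceTimeIdx L M × SectorLeg (sectorCount (d * k - 1))),
          klWtPinnedSumOf L M β μ K (d * k - 1) m (klEffectiveAction L M β U μ K klE0 0) qw.1 qw.2) +
        ∑ k' ∈ range k, ⨆ qw : Fin m × (SpaceTimeIdx L M × SectorLeg (sectorCount (d * k - 1))),
          klWtPinnedSumOf L M β μ K (d * k - 1) m (klTowerIncr L M β U μ K d k') qw.1 qw.2 := by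
  unfold klTowerMeasWt
  rcases isEmpty_or_nonempty (Fin m × (SpaceTimeIdx L M × SectorLeg (sectorCount (d * k - 1)))) with h | h
  · simp [Real.iSup_of_isEmpty]
  · refine ciSup_le fun qw => (klWtPinnedSumOf_klTowerInput_le hβ U μ K d k m qw.1 qw.2).trans (add_le_add ?_ (sum_le_sum fun k' _ => ?_))
    · exact le_ciSup (f := fun qw' : Fin m × (SpaceTimeIdx L M × SectorLeg (sectorCount (d * k - 1))) =>
        klWtPinnedSumOf L M β μ K (d * k - 1) m (klEffectiveAction L M β U μ K klE0 0) qw'.1 qw'.2) (Set.finite_range _).bddAbove qw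
    · exact le_ciSup (f := fun qw' : Fin m × (SpaceTimeIdx L M × SectorLeg (sectorCount (d * k - 1))) =>
        klWtPinnedSumOf L M β μ K (d * k - 1) m (klTowerIncr L M β U μ K d k') qw'.1 qw'.2) (Set.finite_range _).bddAbove qw

/-- **`μ k ≤` re-measured `𝒱_0` + Σ re-measured increments (levelled track, level-count `F`).** -/
theorem klTowerMeasLev_le_remeasured_sum {β : ℝ} (hβ : 0 ≤ β) (U μ : ℝ) (K : TrigPolyC4v) (d k m F : ℕ) :
    klTowerMeasLev L M β U μ K d k m F ≤
      (⨆ Ωe : {Ωe : Fin m → Option (SectorLeg (sectorCount (d * k - 1))) // levelCount Ωe = F},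
          klLevNormOf L M β μ K (d * k - 1) m (klEffectiveAction L M β U μ K klE0 0) Ωe.1) +
        ∑ k' ∈ range k, ⨆ Ωe : {Ωe : Fin m → Option (SectorLeg (sectorCount (d * k - 1))) // levelCount Ωe = F},
          klLevNormOf L M β μ K (d * k - 1) m (klTowerIncr L M β U μ K d k') Ωe.1 := by
  unfold klTowerMeasLev
  rcases isEmpty_or_nonempty {Ωe : Fin m → Option (SectorLeg (sectorCount (d * k - 1))) // levelCount Ωe = F} with h | h
  · simp [Real.iSup_of_isEmpty]
  · refine ciSup_le fun Ωe => (klLevNormOf_klTowerInput_le hβ U μ K d k m Ωe.1).trans (add_le_add ?_ (sum_le_sum fun k' _ => ?_))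
    · exact le_ciSup (f := fun Ωe' : {Ωe' : Fin m → Option (SectorLeg (sectorCount (d * k - 1))) // levelCount Ωe' = F} =>
        klLevNormOf L M β μ K (d * k - 1) m (klEffectiveAction L M β U μ K klE0 0) Ωe'.1) (Set.finite_range _).bddAbove Ωe
    · exact le_ciSup (f := fun Ωe' : {Ωe' : Fin m → Option (SectorLeg (sectorCount (d * k - 1))) // levelCount Ωe' = F} =>
        klLevNormOf L M β μ K (d * k - 1) m (klTowerIncr L M β U μ K d k') Ωe'.1) (Set.finite_range _).bddAbove Ωe

end Summit.HubbardSuperconductivity.HubbardSuperconductivity.Theorems.EngineV8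

end
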